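import Summits.Schanuel.Schanuel.Theorems.RootDecomp1ResidueSieve
import Summits.Schanuel.Schanuel.Theorems.RootDecomp1KHyper19
import Summits.Schanuel.Schanuel.Theorems.RootDecomp1KGeneric13

/-!
# RootDecomp1PowerLineOrder — part 01 — PORT NOTE (census-1 gen 14, 2026-08-31): port of HOME/decomp-schanuel-lens-1/g32/RootDecomp1PowerLineOrder.lean (sha256 b1550f115a5d…, 602 l; critic VERDICT STATUS L1599 (e) PORT GO LOW; writer re-check L1600) in two parts (cut at §5b); `set_option linter.*` lines dropped; statements/proofs verbatim; `--supports stmt-Schanuel-30353`; rung 0. The lens's header follows.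
# RootDecomp1 — lens 1, gen 32: «PowerLineLadder», part 2 — the power-line cell of D₃ is decided DOWN TO A
# FINITE EXPONENTIAL LIOUVILLE ORDER (`7n + 3` at level `n`; `17` for the power line)
Companion of `RootDecomp1PowerLineLadder.lean` (same seat, same gen; read that header first).  Part 1 decided item
D's power-line cell `(w, w², w³)` on the HYPER-Liouville class (every exponential order) by citing lens 6's
`algebraicIndependent_curvePt_of_hyperLiouville`.  This part is the next rung DOWN the Diophantine ladder and is a
NEW theorem: the same algebraic independence `ℓ, e^ℓ, …, e^{ℓⁿ}` for reals of a FIXED finite exponential order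
`7n + 3` (tree predicate `RootDecomp1KGeneric.LiouvilleOrder`, lens 6 gen 13; strictly weaker than
`HyperLiouville` = every order: `LiouvilleOrder.of_hyperLiouville`).
THE ONE CHANGE to lens 6's 300-line proof (copied verbatim otherwise, private helpers included): lens 6 chooses
the ORDER `m = ⌈C_P⌉ + 7n + 2` as a function of the hypothetical relation `P` and takes any approximant with
`q ≥ m`; but the endgame (`endgame_gen`) only needs `C_P · q^{7n+2} ≤ q^m`.  Taking the FIXED order `m = 7n + 3`
and an approximant with `q ≥ ⌈C_P⌉ + 2` gives `q^{7n+3} = q · q^{7n+2} ≥ C_P q^{7n+2}` — the `P`-dependence moves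
from the ORDER to the DENOMINATOR, which `LiouvilleOrder k` supplies for free («rationals of arbitrarily large
denominator»).  So:
* §5 `algebraicIndependent_curvePt_of_liouvilleOrder (hX) (n) (hℓ : LiouvilleOrder (6n+1+n+1+1) ℓ) (hℓ0 : 0 < ℓ) :
  AlgebraicIndependent ℚ (curvePt n ℓ)`.
* §6 consequences for item D's power-line cell at level `n = 2` (order `17`): `e^ℓ, e^{ℓ²}` (with `ℓ`) a.i. ⇒
  PowerValueTwo(ℓ) (`powerValueTwo_of_liouvilleOrder`), and ITEM D (binders verbatim) on the cell
  `range z = range (ℓ, ℓ², ℓ³)` for every real `ℓ > 0` of exponential order `17`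
  (`disjointSaturatedEssentialSchanuel_powerTriple_of_liouvilleOrder`), mod `hX`; `_NW` form mod the registered
  fact NW 1996 Thm 5 (1) only.
* §7 the ladder's recorded CEILING: the specialisation engine needs `|ℓ − p/q| < exp(−c_P q^{7n+2})`; below
  exponential order (e.g. `LogSqLiouville`, every-polynomial-order Liouville numbers such as `Σ 10^{-k!}`,
  Diophantine `w`) it is silent — the power-line cell stays OPEN there (texts).
The exponent `7n + 3` is lens 6's bookkeeping (`a = 6n + 1`, `b = n` in `endgame_gen`), not optimised; the honest
expectation from the parameter count (degree `~q^n`, log-height `~log q`, measure exponent `N² Y (log)²`) is that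
order `2n + 1 + ε` suffices — NOT claimed here.
Sorry-free; standard axioms; imports tree Theorems only.  Port target (writer-1, if cleared):
`Summits/Schanuel/Schanuel/Theorems/RootDecomp1PowerLineOrder.lean`, `--supports stmt-Schanuel-30353`
(and, at lens 6's discretion, `stmt-Schanuel-33364`: these reals are in `FiniteOrderLiouvilleSchanuel`'s scope when
not hyper-Liouville).  Nothing here proves Schanuel; rung 0.
-/

noncomputable section

open Complex IntermediateField Filter Polynomial

namespace Summit.Schanuel.Schanuel.Theorems.RootDecomp1PowerLineLadder

open Summit.Schanuel.Schanuel.Theorems.RootDecomp1KHyper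
open Summit.Schanuel.Schanuel.Theorems.RootDecomp1KHyper.HyperCell
open Summit.Schanuel.Schanuel.Theorems.RootDecomp1KGeneric (LiouvilleOrder)
open Summit.Schanuel.Schanuel.Theorems.RootDecomp1AdditiveCellsD (powerTriple disjointSchanuel_powerTriple_iff)
open Literature.NumberTheory.Transcendental (NesterenkoWaldschmidt1996_thm_5_1)

variable {n K : ℕ}

/-! ## §5  Lens 6's curve theorem at FINITE exponential order (private helpers copied verbatim from
`RootDecomp1KHyper12`) -/

/-- §16b. Roots: a root within ‖A(w)‖^{1/N}, Gauss, Mahler: auxiliary statement `one_le_mahlerMeasure_map_of_ne_zero` (lens 6 gen 9 node, ported verbatim). -/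
private theorem one_le_mahlerMeasure_map_of_ne_zero {R : ℤ[X]} (hR : R ≠ 0) :
    1 ≤ (R.map (Int.castRingHom ℂ)).mahlerMeasure := by
  refine one_le_mahlerMeasure_of_one_le_norm_leadingCoeff ?_
  rw [Polynomial.leadingCoeff_map_of_injective (RingHom.injective_int _), eq_intCast,
    Complex.norm_intCast]
  exact_mod_cast Int.one_le_abs (Polynomial.leadingCoeff_ne_zero.mpr hR)

/-- §16b. Roots: a root within ‖A(w)‖^{1/N}, Gauss, Mahler: auxiliary statement `mahlerMeasure_le_of_dvd` (lens 6 gen 9 node, ported verbatim). -/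
private theorem mahlerMeasure_le_of_dvd {Q A : ℤ[X]} (hdvd : Q ∣ A) (hA : A ≠ 0) :
    (Q.map (Int.castRingHom ℂ)).mahlerMeasure ≤ (A.map (Int.castRingHom ℂ)).mahlerMeasure := by
  obtain ⟨R, rfl⟩ := hdvd
  have hR : R ≠ 0 := right_ne_zero_of_mul hA
  rw [Polynomial.map_mul, mahlerMeasure_mul]
  calc (Q.map (Int.castRingHom ℂ)).mahlerMeasure = (Q.map (Int.castRingHom ℂ)).mahlerMeasure * 1 :=
        (mul_one _).symm
    _ ≤ _ := mul_le_mul_of_nonneg_left (one_le_mahlerMeasure_map_of_ne_zero hR)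
        (mahlerMeasure_nonneg _)

/-- §16c. Numerical lemmas: auxiliary statement `log_le_self_of_nonneg` (lens 6 gen 9 node, ported verbatim). -/
private theorem log_le_self_of_nonneg {x : ℝ} (h0 : 0 ≤ x) : Real.log x ≤ x := by
  rcases eq_or_lt_of_le h0 with h | h
  · rw [← h, Real.log_zero]
  · linarith [Real.log_le_sub_one_of_pos h]

/-- §16d. The theorem: auxiliary statement `eval_map_intCast` (lens 6 gen 9 node, ported verbatim). -/
private theorem eval_map_intCast (P : ℤ[X]) (x : ℂ) : (P.map (Int.castRingHom ℂ)).eval x = aeval x P := by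
  rw [Polynomial.eval_map, Polynomial.aeval_def, algebraMap_int_eq]

/-- §16h. Every level: the moment curve (ℓ, ℓ², …, ℓⁿ) through a hyper-Liouville ℓ: auxiliary statement `apply_le_totalDegree'` (lens 6 gen 9 node, ported verbatim). -/
private theorem apply_le_totalDegree' {P : MvPolynomial (Fin (n + 1)) ℤ} {s : Fin (n + 1) →₀ ℕ}
    (hs : s ∈ P.support) (i : Fin (n + 1)) : s i ≤ P.totalDegree := by
  refine le_trans ?_ (MvPolynomial.le_totalDegree hs)
  by_cases hi : i ∈ s.support
  · exact Finset.single_le_sum (f := fun j => s j) (fun _ _ => Nat.zero_le _) hi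
  · simp [Finsupp.notMem_support_iff.mp hi]

set_option maxHeartbeats 1600000 in
/-- **Theorem (every level, FINITE exponential order, mod the support statement `hX`).** For a real `ℓ > 0`
of exponential Liouville order `7n + 3` (`LiouvilleOrder (6n+1+n+1+1) ℓ`: rationals `p/q` of arbitrarily large
`q` with `|ℓ − p/q| < exp(−q^{7n+3})` — NOT necessarily hyper-Liouville) the `n + 1` numbers
`ℓ, e^ℓ, e^{ℓ²}, …, e^{ℓⁿ}` are algebraically independent over `ℚ`.  Lens 6's proof of
`algebraicIndependent_curvePt_of_hyperLiouville` VERBATIM except for the choice of the approximant: the original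
asks the order `m = ⌈C_P⌉ + 7n + 2` (depending on the relation `P`); here the order is the FIXED `7n + 3` and the
`P`-dependence is moved into the size of the denominator (`q ≥ ⌈C_P⌉ + 2`, so `q^{7n+3} ≥ C_P q^{7n+2}`). -/
theorem algebraicIndependent_curvePt_of_liouvilleOrder (hX : ExplicitRatExpApprox) {ℓ : ℝ} (n : ℕ)
    (hℓ : LiouvilleOrder (6 * n + 1 + n + 1 + 1) ℓ) (hℓ0 : 0 < ℓ) :
    AlgebraicIndependent ℚ (curvePt n (ℓ : ℂ)) := by
  by_contra hdep
  -- an integer relation `P(ℓ, e^ℓ, …, e^{ℓⁿ}) = 0`, `P ≠ 0`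
  obtain ⟨P, hP0, hPu⟩ : ∃ P : MvPolynomial (Fin (n + 1)) ℤ, P ≠ 0 ∧
      MvPolynomial.aeval (curvePt n (ℓ : ℂ)) P = 0 := by
    have h1 : ¬ Function.Injective
        (MvPolynomial.aeval (curvePt n (ℓ : ℂ)) : MvPolynomial (Fin (n + 1)) ℚ →ₐ[ℚ] ℂ) := hdep
    rw [injective_iff_map_eq_zero] at h1
    push Not at h1
    obtain ⟨g, hg0, hgne⟩ := h1
    obtain ⟨N, G, hN, hG⟩ := exists_int_mul_eq_map g
    refine ⟨G, ?_, ?_⟩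
    · intro hG0
      rw [hG0, map_zero] at hG
      have hC : (MvPolynomial.C (N : ℚ) : MvPolynomial (Fin (n + 1)) ℚ) ≠ 0 :=
        MvPolynomial.C_eq_zero.not.mpr (by exact_mod_cast hN)
      exact (mul_ne_zero hC hgne) hG.symm
    · rw [← mvaeval_int_map _ G, hG, map_mul, MvPolynomial.aeval_C, hg0, mul_zero]
  have hFℓ : FC P ℓ = 0 := by
    have h : ((FC P ℓ : ℝ) : ℂ) = 0 := by rw [FC_cast]; exact hPu
    exact_mod_cast h
  -- the total degree, a monomial of the support, its fibre polynomial, the collision polynomial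
  set d : ℕ := P.totalDegree with hd
  obtain ⟨t, ht⟩ : ∃ t, t ∈ P.support := by
    obtain ⟨t, ht⟩ := MvPolynomial.ne_zero_iff.mp hP0
    exact ⟨t, MvPolynomial.mem_support_iff.mpr ht⟩
  have hg0 : fibC P t ≠ 0 := fibC_ne_zero P ht
  obtain ⟨δ₀, hδ₀, hball⟩ := exists_ball_eval_ne_zero ((fibC P t).map (Int.castRingHom ℂ))
    ((Polynomial.map_ne_zero_iff (RingHom.injective_int _)).mpr hg0) ℓ
  obtain ⟨δ₂, hδ₂, hball₂⟩ := exists_ball_eval_ne_zero (collPoly n d) (collPoly_ne_zero n d) ℓ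
  -- local Lipschitz bound of `x ↦ P(x, e^x, …, e^{xⁿ})` at `ℓ`
  obtain ⟨Kl, δ₁, hKl0, hδ₁, hlipF⟩ := exists_lipschitz_FC P ℓ
  set M : ℝ := Kl + 1 with hM
  have hM0 : 0 < M := by rw [hM]; linarith
  -- constants (depend on `ℓ, n` and `P` only)
  have hmv0 : (0 : ℝ) ≤ (mvlen P : ℝ) := by exact_mod_cast mvlen_nonneg P
  set Sr : ℝ := ((mvlen P : ℤ) : ℝ) + 1 with hSr
  have hSr1 : 1 ≤ Sr := by rw [hSr]; linarith
  have hlogSr : 0 ≤ Real.log Sr := Real.log_nonneg hSr1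
  set cN : ℝ := (d : ℝ) * (ℓ + 2) ^ n + 1 with hcN
  have hcN1 : 1 ≤ cN := by
    rw [hcN]; have : (0 : ℝ) ≤ (d : ℝ) * (ℓ + 2) ^ n := by positivity
    linarith
  have hcN0 : 0 ≤ cN := by linarith
  set c0 : ℝ := 1280000000 * 4 * 27 ^ 2 with hc0
  set cY : ℝ := (d : ℝ) * (ℓ + 2) + Real.log Sr + 3 with hcY
  have hcY0 : 0 ≤ cY := by positivity
  set c : ℝ := c0 * (cN ^ 2 * (1 + cN) ^ 2) * cY with hc
  have hc0' : 0 ≤ c := by positivity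
  set C : ℝ := cN * c + d + M + 1 + |Real.log δ₀| + |Real.log δ₁| + |Real.log δ₂| + |Real.log ℓ|
    with hC
  have habs0 := abs_nonneg (Real.log δ₀)
  have habs1 := abs_nonneg (Real.log δ₁)
  have habs2 := abs_nonneg (Real.log δ₂)
  have habsℓ := abs_nonneg (Real.log ℓ)
  have hd0 : (0 : ℝ) ≤ d := Nat.cast_nonneg d
  have hcNc0 : 0 ≤ cN * c := by positivity
  have hCend : cN * c + d + M + 1 ≤ C := by rw [hC]; linarith
  have hC0 : 0 ≤ C := by linarith [hM0.le]
  have hCd : (d : ℝ) + 1 ≤ C := by linarith [hM0.le]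
  set m : ℕ := 6 * n + 1 + n + 1 + 1 with hm
  -- the approximation `r = p/q`: `q ≥ ⌈C⌉ + 2`, `|ℓ − r| < exp(−q^m)`, `m = 7n + 3` FIXED
  obtain ⟨r, hden, hne, hlt⟩ := hℓ (⌈C⌉₊ + 2)
  set q : ℕ := r.den with hq
  have hq2 : 2 ≤ q := le_trans (by omega) hden
  have hq1 : 1 ≤ q := by omega
  have hq0 : q ≠ 0 := by omega
  have hqC : (q : ℂ) ≠ 0 := by exact_mod_cast hq0
  have hq1r : (1 : ℝ) ≤ q := by exact_mod_cast hq1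
  have hq2r : (2 : ℝ) ≤ q := by exact_mod_cast hq2
  have hqn1 : (1 : ℝ) ≤ (q : ℝ) ^ n := one_le_pow₀ hq1r
  have hCq : C ≤ (q : ℝ) := by
    have h1 : ((⌈C⌉₊ + 2 : ℕ) : ℝ) ≤ q := by exact_mod_cast hden
    push_cast at h1
    linarith [Nat.le_ceil C]
  have hdq : d < q := by
    have : (d : ℝ) + 1 ≤ q := hCd.trans hCq
    exact_mod_cast (by linarith : (d : ℝ) < q)
  set η : ℝ := |ℓ - r| with hη
  have hη0 : 0 < η := abs_pos.mpr (sub_ne_zero.mpr hne)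
  have hηlt : η < Real.exp (-((q : ℝ) ^ m)) := hlt
  have hqm1 : (q : ℝ) ≤ (q : ℝ) ^ m := le_self_pow₀ hq1r (by omega)
  have hηC : η < Real.exp (-C) := hηlt.trans_le (Real.exp_le_exp.mpr (by linarith))
  have hη_of : ∀ x : ℝ, 0 < x → |Real.log x| ≤ C → η < x := by
    intro x hx hlx
    refine hηC.trans_le ?_
    calc Real.exp (-C) ≤ Real.exp (Real.log x) :=
          Real.exp_le_exp.mpr (by linarith [neg_abs_le (Real.log x)])
      _ = x := Real.exp_log hx
  have hηδ₀ : η < δ₀ := hη_of δ₀ hδ₀ (by rw [hC]; linarith [hM0.le])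
  have hηδ₁ : η < δ₁ := hη_of δ₁ hδ₁ (by rw [hC]; linarith [hM0.le])
  have hηδ₂ : η < δ₂ := hη_of δ₂ hδ₂ (by rw [hC]; linarith [hM0.le])
  have hηℓ : η < ℓ := hη_of ℓ hℓ0 (by rw [hC]; linarith [hM0.le])
  have hη1 : η ≤ 1 := by
    refine hηC.le.trans ?_
    rw [Real.exp_le_one_iff]; linarith
  -- `r > 0`, `r = p/q` with `p ∈ ℕ`
  have hr0 : 0 < r := by
    have h1 : |ℓ - r| < ℓ := hηℓ
    have h2 : (0 : ℝ) < r := by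
      have := abs_lt.mp h1; linarith [this.2]
    exact_mod_cast h2
  set p : ℕ := r.num.natAbs with hp
  have hpnum : (p : ℤ) = r.num := by
    rw [hp]; exact Int.natAbs_of_nonneg (Rat.num_pos.mpr hr0).le
  have hrq : (r : ℝ) = (p : ℝ) / q := by
    rw [Rat.cast_def, hq, show ((r.num : ℤ) : ℝ) = (p : ℝ) by rw [← hpnum]; simp]
  have hrC : ((r : ℝ) : ℂ) = (p : ℂ) / q := by
    rw [hrq, Complex.ofReal_div, Complex.ofReal_natCast, Complex.ofReal_natCast]
  have hpq : (p : ℝ) ≤ (ℓ + 1) * q := by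
    have hq0r : (q : ℝ) ≠ 0 := by positivity
    have h1 : (p : ℝ) = (r : ℝ) * q := by rw [hrq]; field_simp
    have h2 : (r : ℝ) ≤ ℓ + 1 := by
      have := abs_le.mp hη1; linarith [this.1]
    rw [h1]
    exact mul_le_mul_of_nonneg_right h2 (by positivity)
  have hpq' : (p : ℝ) + q ≤ (ℓ + 2) * q := by linarith
  -- `q^m ≥ C q^{7n+2}`
  have hqm : C * (q : ℝ) ^ (6 * n + 1 + n + 1) ≤ (q : ℝ) ^ m := by
    have h1 : C * (q : ℝ) ^ (6 * n + 1 + n + 1) ≤ (q : ℝ) * (q : ℝ) ^ (6 * n + 1 + n + 1) :=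
      mul_le_mul_of_nonneg_right hCq (by positivity)
    have h2 : (q : ℝ) * (q : ℝ) ^ (6 * n + 1 + n + 1) = (q : ℝ) ^ m := by
      rw [hm]; exact (pow_succ' (q : ℝ) (6 * n + 1 + n + 1)).symm
    exact h1.trans_eq h2
  -- the univariate polynomial `A = q^d P(p/q, T^{E₁}, …, T^{Eₙ})`
  have hD : ∀ s ∈ P.support, s 0 ≤ d := fun s hs => apply_le_totalDegree' hs 0
  have hN1 : ∀ s ∈ P.support, exC n q p s ≤ d * (p + q) ^ n := fun s hs => exC_le hs q p
  have hcoll : (collPoly n d).eval ((p : ℂ) / q) ≠ 0 := by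
    have h := hball₂ r (fun h => hne h.symm) (by rw [abs_sub_comm]; exact hηδ₂)
    rwa [hrC] at h
  have hinj : ∀ s ∈ P.support, exC n q p s = exC n q p t → ∀ i : Fin n, s i.succ = t i.succ :=
    fun s hs h => exC_inj hq0 hcoll (fun i => apply_le_totalDegree' hs _)
      (fun i => apply_le_totalDegree' ht _) h
  set A : ℤ[X] := AC P d p q with hAdef
  have hgr : aeval ((p : ℂ) / q) (fibC P t) ≠ 0 := by
    have h := hball r (fun h => hne h.symm) (by rw [abs_sub_comm]; exact hηδ₀)
    rwa [eval_map_intCast, hrC] at h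
  have hAcoef : A.coeff (exC n q p t) ≠ 0 := by
    intro h0
    have h1 := coeff_AC_exC_cast P hD hq0 (t := t) hinj
    rw [← hAdef, h0, Int.cast_zero] at h1
    exact (mul_ne_zero (pow_ne_zero _ hqC) hgr) h1.symm
  have hA0 : A ≠ 0 := fun h => hAcoef (by rw [h, Polynomial.coeff_zero])
  have hAdeg : A.natDegree ≤ d * (p + q) ^ n := natDegree_AC_le P d p q hN1
  -- its value at `γ = e^{1/qⁿ}`
  set γ : ℂ := cexp (((q : ℂ) ^ n)⁻¹) with hγ
  have hγE : ∀ i : Fin n, γ ^ Ewt n q p i = cexp (((r : ℝ) : ℂ) ^ ((i : ℕ) + 1)) := by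
    intro i
    rw [hγ, ← Complex.exp_nat_mul, Ewt_cast hq0, hrC, mul_assoc,
      mul_inv_cancel₀ (pow_ne_zero _ hqC), mul_one]
  have hvec : (Fin.cons ((p : ℂ) / q) fun i : Fin n => γ ^ Ewt n q p i) =
      curvePt n ((r : ℝ) : ℂ) := by
    rw [curvePt, ← hrC]
    congr 1
    funext i
    rw [hγE i, hrC]
  have hAγ : aeval γ A = (q : ℂ) ^ d * ((FC P r : ℝ) : ℂ) := by
    rw [hAdef, aeval_AC P hD hq0, hvec, FC_cast]
  have hAγ_le : ‖aeval γ A‖ ≤ (q : ℝ) ^ d * M * η := by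
    rw [hAγ, norm_mul, norm_pow, Complex.norm_natCast, Complex.norm_real, Real.norm_eq_abs]
    have h1 : |FC P r| ≤ M * η := by
      have h2 := hlipF r (by rw [abs_sub_comm]; exact hηδ₁)
      rw [hFℓ, sub_zero, abs_sub_comm] at h2
      calc |FC P r| ≤ Kl * η := h2
        _ ≤ M * η := mul_le_mul_of_nonneg_right (by rw [hM]; linarith) hη0.le
    calc (q : ℝ) ^ d * |FC P r| ≤ (q : ℝ) ^ d * (M * η) := by gcongr
      _ = (q : ℝ) ^ d * M * η := by ring
  have hN1r : ((d * (p + q) ^ n : ℕ) : ℝ) ≤ cN * (q : ℝ) ^ n := by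
    rw [Nat.cast_mul, Nat.cast_pow, Nat.cast_add]
    have h1 : ((p : ℝ) + q) ^ n ≤ ((ℓ + 2) * q) ^ n := pow_le_pow_left₀ (by positivity) hpq' n
    rw [mul_pow] at h1
    have h2 : (d : ℝ) * ((p : ℝ) + q) ^ n ≤ d * ((ℓ + 2) ^ n * (q : ℝ) ^ n) :=
      mul_le_mul_of_nonneg_left h1 hd0
    have h3 : (d : ℝ) * ((ℓ + 2) ^ n * (q : ℝ) ^ n) = ((d : ℝ) * (ℓ + 2) ^ n) * (q : ℝ) ^ n := by
      ring
    have h4 : ((d : ℝ) * (ℓ + 2) ^ n) * (q : ℝ) ^ n ≤ cN * (q : ℝ) ^ n :=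
      mul_le_mul_of_nonneg_right (by rw [hcN]; linarith) (by positivity)
    linarith
  have hNA : (A.natDegree : ℝ) ≤ cN * (q : ℝ) ^ n :=
    le_trans (by exact_mod_cast hAdeg) hN1r
  rcases Nat.eq_zero_or_pos A.natDegree with hNA0 | hNApos
  · -- `A` is a non-zero constant: `1 ≤ |A| = |A(γ)| ≤ q^d M η`
    have ha : A = Polynomial.C (A.coeff 0) := Polynomial.eq_C_of_natDegree_eq_zero hNA0
    have ha0 : A.coeff 0 ≠ 0 := fun h => hA0 (by rw [ha, h, map_zero])
    have h1 : (1 : ℝ) ≤ ‖aeval γ A‖ := by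
      rw [ha, aeval_C, algebraMap_int_eq, eq_intCast, Complex.norm_intCast]
      exact_mod_cast Int.one_le_abs ha0
    refine endgame_gen (N := 0) (D := d) (δ := 1) (Φ := 0) (cN := cN) (a := 6 * n + 1) (b := n)
      hq1 hc0' hM0 (by simp; positivity) (by simp) (by positivity) ?_ hηlt hCend hqm
    rw [pow_zero]; exact h1.trans hAγ_le
  -- a root `ξ` of `A` with `‖γ − ξ‖^{deg A} ≤ ‖A(γ)‖`
  set APC : ℂ[X] := A.map (Int.castRingHom ℂ) with hAPC
  have hACdeg : APC.natDegree = A.natDegree := by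
    rw [hAPC, Polynomial.natDegree_map_eq_of_injective (RingHom.injective_int _)]
  have hAClead : 1 ≤ ‖APC.leadingCoeff‖ := by
    rw [hAPC, Polynomial.leadingCoeff_map_of_injective (RingHom.injective_int _), eq_intCast,
      Complex.norm_intCast]
    exact_mod_cast Int.one_le_abs (Polynomial.leadingCoeff_ne_zero.mpr hA0)
  obtain ⟨ξ, hξroot, hξle⟩ :=
    exists_root_pow_le_norm_eval APC hAClead (by rw [hACdeg]; exact hNApos) γ
  rw [hACdeg, hAPC, eval_map_intCast] at hξle
  have hAξ : aeval ξ A = 0 := by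
    have h := hξroot
    rw [Polynomial.IsRoot.def, hAPC, eval_map_intCast] at h
    exact h
  -- the minimal polynomial `Q` of `ξ` divides `A`
  have hξalg : IsAlgebraic ℚ ξ := (IsFractionRing.isAlgebraic_iff ℤ ℚ ℂ).mp ⟨A, hA0, hAξ⟩
  obtain ⟨Q, hQirr, hQdeg, hQξ⟩ :=
    Literature.NumberTheory.Transcendental.NesterenkoWaldschmidt1996.exists_irreducible_int_aeval_eq_zero
      hξalg
  have hQA : Q ∣ A := dvd_of_irreducible_of_common_root hQirr hQdeg hQξ hAξ
  have hnA : Q.natDegree ≤ A.natDegree := Polynomial.natDegree_le_of_dvd hQA hA0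
  have hnN1 : Q.natDegree ≤ d * (p + q) ^ n := hnA.trans hAdeg
  -- heights: `M(Q) ≤ M(A) ≤ L(A) ≤ (p+q)^d (mvlen P + 1) =: L`
  set L : ℝ := (((p : ℤ) + q : ℤ) : ℝ) ^ d * Sr with hL
  have hpqR : (((p : ℤ) + q : ℤ) : ℝ) = (p : ℝ) + q := by
    rw [Int.cast_add, Int.cast_natCast, Int.cast_natCast]
  have hpq1 : (1 : ℝ) ≤ (((p : ℤ) + q : ℤ) : ℝ) := by
    rw [hpqR]; linarith [(Nat.cast_nonneg p : (0 : ℝ) ≤ p)]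
  have hL1 : 1 ≤ L := one_le_mul_of_one_le_of_one_le (one_le_pow₀ hpq1) hSr1
  have hMQ : (Q.map (Int.castRingHom ℂ)).mahlerMeasure ≤ L := by
    refine (mahlerMeasure_le_of_dvd hQA hA0).trans ((mahlerMeasure_map_le_sum hAdeg).trans ?_)
    have h1 := sum_abs_coeff_AC_le P hD hN1
    have h2 : (∑ j ∈ Finset.range (d * (p + q) ^ n + 1), |(A.coeff j : ℝ)|) ≤
        (((p : ℤ) + q : ℤ) : ℝ) ^ d * (mvlen P : ℝ) := by
      rw [hAdef]; exact_mod_cast h1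
    refine h2.trans ?_
    rw [hL]
    exact mul_le_mul_of_nonneg_left (by rw [hSr]; linarith) (by positivity)
  set Y : ℝ := Real.log 16 + Real.log L with hY
  have hlogL0 : 0 ≤ Real.log L := Real.log_nonneg hL1
  have hlog16 : 0 ≤ Real.log 16 := Real.log_nonneg (by norm_num)
  have h16Y : Real.log 16 ≤ Y := by rw [hY]; linarith
  have hMQY : Real.log (Q.map (Int.castRingHom ℂ)).mahlerMeasure ≤ Y := by
    have hMpos : 0 < (Q.map (Int.castRingHom ℂ)).mahlerMeasure :=
      mahlerMeasure_pos_of_ne_zero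
        ((Polynomial.map_ne_zero_iff (RingHom.injective_int _)).mpr hQirr.ne_zero)
    have := Real.log_le_log hMpos hMQ
    rw [hY]; linarith
  -- THE MEASURE at the rational exponent `1/qⁿ`
  set r' : ℚ := ((q ^ n : ℕ) : ℚ)⁻¹ with hr'
  have hqn0 : q ^ n ≠ 0 := pow_ne_zero _ hq0
  have hr'0 : r' ≠ 0 := by rw [hr']; exact inv_ne_zero (by exact_mod_cast hqn0)
  have hr'C : cexp (r' : ℂ) = γ := by rw [hr', hγ]; push_cast; rfl
  have hr'den : (r'.den : ℝ) = (q : ℝ) ^ n := by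
    rw [hr', Rat.inv_natCast_den, if_neg hqn0]; push_cast; rfl
  have hXr := hX r' hr'0 Q hQirr hQdeg ξ hQξ Y h16Y hMQY
  rw [hr'C] at hXr
  -- `Φ ≤ c q^{6n+1}`
  have hYq : Y ≤ cY * q := by
    have hlogL : Real.log L = d * Real.log (((p : ℤ) + q : ℤ) : ℝ) + Real.log Sr := by
      rw [hL, Real.log_mul (by positivity) (by positivity), Real.log_pow]
    have h1 : Real.log (((p : ℤ) + q : ℤ) : ℝ) ≤ (ℓ + 2) * q := by
      refine (log_le_self_of_nonneg (by linarith)).trans ?_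
      rw [hpqR]; exact hpq'
    have h2 : (d : ℝ) * Real.log (((p : ℤ) + q : ℤ) : ℝ) ≤ d * ((ℓ + 2) * q) :=
      mul_le_mul_of_nonneg_left h1 (by positivity)
    have h3 : Real.log Sr ≤ Real.log Sr * q := le_mul_of_one_le_right hlogSr hq1r
    have h4 : Real.log 16 ≤ 3 * q := by linarith [log_sixteen_lt_three]
    have hexp : ((d : ℝ) * (ℓ + 2) + Real.log Sr + 3) * q =
        d * ((ℓ + 2) * q) + Real.log Sr * q + 3 * q := by ring
    rw [hY, hlogL, hcY, hexp]
    linarith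
  have hΦ : C₀rat r' * (Q.natDegree : ℝ) ^ 2 * Y *
      (Real.log Y + Real.log Q.natDegree) ^ 2 / Real.log Y ^ 2 ≤ c * (q : ℝ) ^ (6 * n + 1) := by
    have h1 : C₀rat r' ≤ c0 * ((q : ℝ) ^ n) ^ 2 := by
      have h := C₀rat_le (ρ := 0) (r := r') (by
        rw [zero_sub, abs_neg, hr']; push_cast
        rw [abs_inv, abs_pow, Nat.abs_cast, ← Nat.cast_pow]
        exact inv_le_one_of_one_le₀ (by exact_mod_cast Nat.one_le_pow _ _ (by omega)))
      rw [abs_zero, mul_pow, hr'den] at h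
      rw [hc0]; convert h using 1; ring
    have h2 := measure_factor_le hQdeg hnN1 h16Y
    have hY0 : 0 < Y := lt_of_lt_of_le (Real.log_pos (by norm_num)) h16Y
    have hC₀0 : 0 ≤ C₀rat r' := by unfold C₀rat; positivity
    have hN1r' : (1 : ℝ) + ((d * (p + q) ^ n : ℕ) : ℝ) ≤ (1 + cN) * (q : ℝ) ^ n := by
      rw [add_mul, one_mul]; linarith
    calc C₀rat r' * (Q.natDegree : ℝ) ^ 2 * Y * (Real.log Y + Real.log Q.natDegree) ^ 2 /
          Real.log Y ^ 2
        = C₀rat r' * ((Q.natDegree : ℝ) ^ 2 * Y * (Real.log Y + Real.log Q.natDegree) ^ 2 /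
            Real.log Y ^ 2) := by ring
      _ ≤ (c0 * ((q : ℝ) ^ n) ^ 2) *
          ((((d * (p + q) ^ n : ℕ) : ℝ)) ^ 2 * (1 + ((d * (p + q) ^ n : ℕ) : ℝ)) ^ 2 * Y) :=
          mul_le_mul h1 h2 (by positivity) (by positivity)
      _ ≤ (c0 * ((q : ℝ) ^ n) ^ 2) * ((cN * (q : ℝ) ^ n) ^ 2 * ((1 + cN) * (q : ℝ) ^ n) ^ 2 *
          (cY * q)) := by gcongr
      _ = c * (q : ℝ) ^ (6 * n + 1) := by rw [hc]; ring
  have hlow : Real.exp (-(C₀rat r' * (Q.natDegree : ℝ) ^ 2 * Y *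
      (Real.log Y + Real.log Q.natDegree) ^ 2 / Real.log Y ^ 2)) ≤ ‖γ - ξ‖ := hXr
  have hδ : ‖γ - ξ‖ ^ A.natDegree ≤ (q : ℝ) ^ d * M * η := hξle.trans hAγ_le
  exact endgame_gen hq1 hc0' hM0 hNA hlow hΦ hδ hηlt hCend hqm

end Summit.Schanuel.Schanuel.Theorems.RootDecomp1PowerLineLadder
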